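import Literature.NumberTheory.EllipticCurves.BigRepModuleDualShiftedEndomorphismProofs
import Literature.NumberTheory.EllipticCurves.CharIdealCokernelDetProofs
import Mathlib.LinearAlgebra.Matrix.Charpoly.LinearMap
import HarnessLib

/-!
# `Ch_Λ((ker(τ_c ∘ L_* − 1))^∨) = (det((1+T)^c·ᵗM − 1))` for the co-induced module `A ⊗ Λ^*` of a
# cofree `A` — the characteristic-ideal computation of [GreenbergVatsal2000] Prop. 2.4, PROVED

Topic `Literature/NumberTheory/EllipticCurves` (namespace = path + `BigRepModule`). THEOREMS ONLY: no
definition, no named fact, no instance, no `sorry`. Cell `bsd-stepL` (typer lane `defn-ty1`, g10),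
module L5 step (S3) of the discharge of the local atom
`JetchevSkinnerWan2017.sigmaLocal_charIdeal_eulerFactor_mem_of_noTamagawaDefect` (K2 support 20495).
Two-line assembly of the tree's
* `BigRepModule.nonempty_characterModule_ker_linearEquiv_quotient_range_mulVecLin`
  (`BigRepModuleDualShiftedEndomorphismProofs`: `(ker E)^∨ ≃ₗ[𝒪⟦T⟧] (Fin n → 𝒪⟦T⟧) ⧸ N·(Fin n → 𝒪⟦T⟧)`,
  `N = (1+T)^c·ᵗM − 1`, by the Mahler transform and Tate's Lemma z.3), and
* `Module.charIdeal_eq_span_det_of_linearEquiv` (`CharIdealCokernelDetProofs`: over a Noetherian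
  UFD, a module isomorphic to `F ⧸ φ(F)` with `det φ ≠ 0` is finitely generated, torsion, with
  characteristic ideal `(det φ)` — Serre, *Local Fields* I §5 Lemma 3 at the height-one localisations).

## The printed statement

[GreenbergVatsal2000] Prop. (2.4) (arXiv:math/9906215 p. 22): "Let `P_ℓ(X) = det((1 − Frob_ℓ X)|_{(V_p)_{I_ℓ}})
∈ 𝒪[X]`. Let `𝓟_ℓ = P_ℓ(ℓ⁻¹γ_ℓ) ∈ Λ = 𝒪[[Γ]]`, where `γ_ℓ` denotes the Frobenius automorphism for `ℓ`
in `Γ`. The characteristic ideal of the `Λ`-module `ℋ_ℓ(ℚ_∞)^` is generated by `𝓟_ℓ`. Its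
`μ`-invariant is zero." Here: for a `p`-primary `𝒪`-module `A`, COFREE of corank `n` (a Pontryagin
dual datum `(Y, tA)` free over `𝒪` with basis `b`), an `𝒪`-linear `L : A → A` with adjoint `Lt` on
`Y` (`tA (Lt y) a = tA y (L a)`; matrix `ᵗM = (toMatrix b b Lt).map C`), `c ∈ ℤ_p`, and ANY
`𝒪⟦T⟧`-linear endomorphism `E` of `A ⊗ Λ^* = BigRepModule 𝒪 p A` with `E Φ = τ_c (L_* Φ) − Φ`:
if `det N ≠ 0`, `N = (1+T)^c · ᵗM − 1`, then the Pontryagin dual `(ker E)^∨` is a finitely generated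
torsion `𝒪⟦T⟧`-module with `Ch((ker E)^∨) = (det N)` — in the application `A = ` the divisible part of
`H¹(I_w, E[p^∞])`, `L = Frob_w`, `c = κ(Frob_w)`, `E` = the conjugation action of Frobenius on
`H¹(I_w, T ⊗ Λ^*) ≅ BigRepModule(H¹(I_w, E[p^∞]))` minus the identity, whose kernel is
`H¹(I_w, ·)^{D_w/I_w}`, and `det N` is `𝓟_w` in Skinner's normalisation.

Also, for step (S5) (identifying `det N` with the Euler factor): `Matrix.det_one_sub_smul_map_eq_aeval_charpolyRev`
(`det(1 − u·M) = charpolyRev(M)(u)`, any commutative algebra), `Matrix.det_smul_map_sub_one_eq_aeval_charpolyRev`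
(`det(u·M − 1) = (−1)ⁿ · charpolyRev(M)(u)`) and `det_shiftedMatrix_eq_aeval_reverse_charpoly`
(`det N = (−1)ⁿ · (charpoly Lt).reverse ((1+T)^c)`) — the printed `𝓟_ℓ = P_ℓ(ℓ⁻¹γ_ℓ)` with
`P_ℓ(X) = det(1 − Frob_ℓ·X)` the REVERSED characteristic polynomial of Frobenius.

HONEST FRAMING: pure `Λ`-module algebra; nothing about Galois cohomology, elliptic curves or BSD is
proved here, and the named local fact is NOT discharged by this file (the arithmetic identification of
`Lt` with Frobenius on a `T_p`-lattice and of `(charpoly Lt).reverse((1+T)^c)` with `eulerFactor`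
remains, steps (S3)/(S5) of `HOME/imc-p1/g13/L5-PLAN`).

References: [GreenbergVatsal2000] Prop. 2.4 and proof (arXiv pp. 21–22); [Serre1979] Chap. I §5 Lemma 3
(p. 22); [CoatesSujatha2006Cyclotomic] §3.3 Lemma 3.3.4 (p. 37); [Tate1966Bourbaki] §5 Lemma z.3;
[PollackWeston2011] Lemma 3.2.
-/

noncomputable section

open Literature.NumberTheory.IwasawaTheory.Greenberg2016

universe u

namespace Literature.NumberTheory.EllipticCurves.Matrix

/-- **`det(1 − u·M) = charpolyRev(M)(u)`**: the determinant of `1 − u·M` over a commutative `R`-algebra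
`S` (`M` a square matrix over `R`, `u ∈ S`) is the REVERSED characteristic polynomial
`charpolyRev M = det(1 − X·M)` (Mathlib) evaluated at `u` — the shape `P_ℓ(X) = det(1 − Frob_ℓ X)`,
`𝓟_ℓ = P_ℓ(ℓ⁻¹γ_ℓ) ∈ Λ`. [cite: GreenbergVatsal2000, Prop. 2.4 (arXiv p. 22: P_ℓ(X) = det((1 − Frob_ℓ X)|…), 𝓟_ℓ = P_ℓ(ℓ⁻¹γ_ℓ))] -/
theorem det_one_sub_smul_map_eq_aeval_charpolyRev {R S : Type*} [CommRing R] [CommRing S]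
    [Algebra R S] {m : Type*} [Fintype m] [DecidableEq m] (M : _root_.Matrix m m R) (u : S) :
    (1 - u • M.map (algebraMap R S)).det = Polynomial.aeval u M.charpolyRev := by
  rw [Matrix.charpolyRev, AlgHom.map_det]
  congr 1
  ext i j
  rw [AlgHom.mapMatrix_apply, Matrix.map_apply, Matrix.sub_apply, Matrix.sub_apply,
    Matrix.smul_apply, Matrix.smul_apply, Matrix.map_apply, Matrix.map_apply, map_sub,
    smul_eq_mul, smul_eq_mul, map_mul, Polynomial.aeval_X, Polynomial.aeval_C,
    Matrix.one_apply, Matrix.one_apply]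
  split_ifs <;> simp

/-- **`det(u·M − 1) = (−1)ⁿ · charpolyRev(M)(u)`** (`n` the size of `M`).
[cite: GreenbergVatsal2000, Prop. 2.4 (arXiv p. 22: 𝓟_ℓ = P_ℓ(ℓ⁻¹γ_ℓ), P_ℓ(X) = det(1 − Frob_ℓ X))] -/
theorem det_smul_map_sub_one_eq_aeval_charpolyRev {R S : Type*} [CommRing R] [CommRing S]
    [Algebra R S] {m : Type*} [Fintype m] [DecidableEq m] (M : _root_.Matrix m m R) (u : S) :
    (u • M.map (algebraMap R S) - 1).det =
      (-1) ^ Fintype.card m * Polynomial.aeval u M.charpolyRev := by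
  rw [← det_one_sub_smul_map_eq_aeval_charpolyRev, ← Matrix.det_neg, neg_sub]

end Literature.NumberTheory.EllipticCurves.Matrix

namespace Literature.NumberTheory.EllipticCurves.BigRepModule

variable {𝒪 : Type u} [CommRing 𝒪] {p : ℕ} [Fact p.Prime] [Algebra ℤ_[p] 𝒪]
  [IsNoetherianRing (PowerSeries 𝒪)] [IsDomain (PowerSeries 𝒪)]
  [UniqueFactorizationMonoid (PowerSeries 𝒪)]
  {A : Type u} [AddCommGroup A] [Module 𝒪 A]
  {Y : Type u} [AddCommGroup Y] [Module 𝒪 Y] {tA : Y →+ (A →+ AddCircle (1 : ℚ))} {n : ℕ}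

/-- **[GreenbergVatsal2000] Prop. 2.4, the characteristic-ideal computation, on the co-induced
model.** For `A` `p`-primary and cofree of corank `n` (dual datum `(Y, tA)` with basis `b`),
`L : A → A` with adjoint `Lt`, `c ∈ ℤ_p`, and any `𝒪⟦T⟧`-linear `E` with `E Φ = τ_c (L_* Φ) − Φ`:
if `N = (1+T)^c · ᵗM − 1` (`ᵗM = (toMatrix b b Lt).map C`) has `det N ≠ 0`, then `(ker E)^∨`
(Mathlib `CharacterModule`) is a finitely generated torsion `𝒪⟦T⟧`-module whose characteristic
ideal is `(det N)` — "the characteristic ideal of `ℋ_ℓ(ℚ_∞)^` is generated by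
`𝓟_ℓ = det(1 − Frob_ℓ X)|_{X = ℓ⁻¹γ_ℓ}`" in matrix form, over any coefficient ring `𝒪` with `𝒪⟦T⟧`
a Noetherian UFD (e.g. `𝒪 = ℤ_p`, `𝒪⟦T⟧ = Λ`).
[cite: GreenbergVatsal2000, Prop. 2.4 and proof (arXiv pp. 21–22)]
[cite: Serre1979, Chap. I §5 Lemma 3 (p. 22)] -/
theorem finite_isTorsion_charIdeal_characterModule_ker_shiftedEndo
    (hA : ∀ a : A, ∃ k : ℕ, p ^ k • a = 0) (hY : IsDualPairing 𝒪 A tA)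
    (b : Module.Basis (Fin n) 𝒪 Y) (L : A →ₗ[𝒪] A) (Lt : Y →ₗ[𝒪] Y)
    (hLt : ∀ (y : Y) (a : A), tA (Lt y) a = tA y (L a)) (c : ℤ_[p])
    (E : BigRepModule 𝒪 p A →ₗ[PowerSeries 𝒪] BigRepModule 𝒪 p A)
    (hE : ∀ Φ, E Φ = translate c (mapRange L Φ) - Φ)
    (hN : (binomSeries 𝒪 c • (LinearMap.toMatrix b b Lt).map (PowerSeries.C (R := 𝒪)) - 1).det ≠ 0) :
    Module.Finite (PowerSeries 𝒪) (CharacterModule (LinearMap.ker E)) ∧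
      Module.IsTorsion (PowerSeries 𝒪) (CharacterModule (LinearMap.ker E)) ∧
        Module.charIdeal (PowerSeries 𝒪) (CharacterModule (LinearMap.ker E)) =
          Ideal.span
            {(binomSeries 𝒪 c • (LinearMap.toMatrix b b Lt).map (PowerSeries.C (R := 𝒪)) - 1).det} := by
  obtain ⟨e⟩ :=
    nonempty_characterModule_ker_linearEquiv_quotient_range_mulVecLin hA hY b L Lt hLt c E hE
  set N := binomSeries 𝒪 c • (LinearMap.toMatrix b b Lt).map (PowerSeries.C (R := 𝒪)) - 1 with hNdef
  have hdet : LinearMap.det (Matrix.toLin' N) = N.det := LinearMap.det_toLin' N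
  have h := Module.charIdeal_eq_span_det_of_linearEquiv (Matrix.toLin' N) (by rwa [hdet]) e
  rwa [hdet] at h

/-- Membership form: `det((1+T)^c · ᵗM − 1) ∈ Ch((ker E)^∨)` (what a one-sided divisibility consumer
needs). [cite: GreenbergVatsal2000, Prop. 2.4 and proof (arXiv pp. 21–22)] -/
theorem det_mem_charIdeal_characterModule_ker_shiftedEndo
    (hA : ∀ a : A, ∃ k : ℕ, p ^ k • a = 0) (hY : IsDualPairing 𝒪 A tA)
    (b : Module.Basis (Fin n) 𝒪 Y) (L : A →ₗ[𝒪] A) (Lt : Y →ₗ[𝒪] Y)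
    (hLt : ∀ (y : Y) (a : A), tA (Lt y) a = tA y (L a)) (c : ℤ_[p])
    (E : BigRepModule 𝒪 p A →ₗ[PowerSeries 𝒪] BigRepModule 𝒪 p A)
    (hE : ∀ Φ, E Φ = translate c (mapRange L Φ) - Φ)
    (hN : (binomSeries 𝒪 c • (LinearMap.toMatrix b b Lt).map (PowerSeries.C (R := 𝒪)) - 1).det ≠ 0) :
    (binomSeries 𝒪 c • (LinearMap.toMatrix b b Lt).map (PowerSeries.C (R := 𝒪)) - 1).det ∈
      Module.charIdeal (PowerSeries 𝒪) (CharacterModule (LinearMap.ker E)) := by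
  rw [(finite_isTorsion_charIdeal_characterModule_ker_shiftedEndo hA hY b L Lt hLt c E hE hN).2.2]
  exact Ideal.mem_span_singleton_self _

omit [IsNoetherianRing (PowerSeries 𝒪)] [IsDomain (PowerSeries 𝒪)]
  [UniqueFactorizationMonoid (PowerSeries 𝒪)] in
/-- **`det N = (−1)ⁿ · charpolyRev(ᵗM)((1+T)^c)`** (basis form): the generator `det((1+T)^c · ᵗM − 1)`
of the characteristic ideal is, up to the sign `(−1)ⁿ`, the REVERSED characteristic polynomial
`charpolyRev (toMatrix b b Lt) = det(1 − X · ᵗM)` (Mathlib `Matrix.charpolyRev`) evaluated at the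
binomial series `(1+T)^c` — the printed `𝓟_ℓ = P_ℓ(ℓ⁻¹γ_ℓ)`, `P_ℓ(X) = det(1 − Frob_ℓ X)`, once `Lt`
is identified with Frobenius (times `ℓ⁻¹`) on the lattice.
[cite: GreenbergVatsal2000, Prop. 2.4 (arXiv p. 22: 𝓟_ℓ = P_ℓ(ℓ⁻¹γ_ℓ), P_ℓ(X) = det(1 − Frob_ℓ X))] -/
theorem det_shiftedMatrix_eq_aeval_charpolyRev (b : Module.Basis (Fin n) 𝒪 Y) (Lt : Y →ₗ[𝒪] Y)
    (c : ℤ_[p]) :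
    (binomSeries 𝒪 c • (LinearMap.toMatrix b b Lt).map (PowerSeries.C (R := 𝒪)) - 1).det =
      (-1) ^ n * Polynomial.aeval (binomSeries 𝒪 c) (LinearMap.toMatrix b b Lt).charpolyRev := by
  have h := Literature.NumberTheory.EllipticCurves.Matrix.det_smul_map_sub_one_eq_aeval_charpolyRev
    (LinearMap.toMatrix b b Lt) (binomSeries 𝒪 c)
  rwa [Fintype.card_fin] at h

omit [IsNoetherianRing (PowerSeries 𝒪)] [IsDomain (PowerSeries 𝒪)]
  [UniqueFactorizationMonoid (PowerSeries 𝒪)] in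
/-- **`det N = (−1)ⁿ · (charpoly Lt).reverse((1+T)^c)`**: the generator `det((1+T)^c · ᵗM − 1)` of the
characteristic ideal is, up to sign, the REVERSED characteristic polynomial of the adjoint `Lt` of `L`
on `Y = T_A` (Mathlib `LinearMap.charpoly`, `Polynomial.reverse`, `Matrix.charpolyRev`) evaluated at
the binomial series `(1+T)^c` — the printed `𝓟_ℓ = P_ℓ(ℓ⁻¹γ_ℓ)`, `P_ℓ(X) = det(1 − Frob_ℓ X)`, once
`Lt` is identified with Frobenius (times `ℓ⁻¹`) on the lattice.
[cite: GreenbergVatsal2000, Prop. 2.4 (arXiv p. 22: 𝓟_ℓ = P_ℓ(ℓ⁻¹γ_ℓ), P_ℓ(X) = det(1 − Frob_ℓ X))] -/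
theorem det_shiftedMatrix_eq_aeval_reverse_charpoly [Module.Free 𝒪 Y] [Module.Finite 𝒪 Y]
    (b : Module.Basis (Fin n) 𝒪 Y) (Lt : Y →ₗ[𝒪] Y) (c : ℤ_[p]) :
    (binomSeries 𝒪 c • (LinearMap.toMatrix b b Lt).map (PowerSeries.C (R := 𝒪)) - 1).det =
      (-1) ^ n * Polynomial.aeval (binomSeries 𝒪 c) (LinearMap.charpoly Lt).reverse := by
  rw [← LinearMap.charpoly_toMatrix Lt b, Matrix.reverse_charpoly]
  exact det_shiftedMatrix_eq_aeval_charpolyRev b Lt c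

end Literature.NumberTheory.EllipticCurves.BigRepModule
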